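import Mathlib
import HarnessLib

/-!
# K6 crux `MuTransfer` (stmt-BirchSwinnertonDyer-19629), stub `stub_x9`: the LEVEL-`e` ALGEBRA of
# KOLY-MEMO §5.7 (MU-TRANSFER-PROOF §1 (F5), §4 Lemma 3 (i), §5 Step 4's exponent count), kernel-checked

Cell `bsd-smallim`, seat `bsd-smallim-k6-c2` (D-0074 group (F)). HONEST FRAMING: theorems only (no
definition, no named fact, D-0026); pure commutative/linear algebra over a field; nothing is asserted
about any curve and nothing is booked. Second KERNEL file for the registered stub `stub_x9` (Kato
μ-transfer on class X9 = KOLY-MEMO Thm. 5.7.1 / Cor. 5.7.2; companion of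
`SmallImageMuTransferMuTransferStubX9MuBookkeeping.lean`). It checks three algebraic sentences of
HOME/koly/MU-TRANSFER-PROOF.md on which Theorem A ("`𝐳_1 ∉ p𝐇¹ ⟹ Ш¹_S(ℚ, 𝒯^∨)` is killed by
`T^{2e−1}`") rests, in models that use Mathlib notions only:

* §1 = (F5): in `Ω = k⟦T⟧` of characteristic `p`, for `p ∤ u`,
  `(1 + T)^{p^m·u} − 1 = T^{p^m} · (unit)` — the depth `e_q = p^{m_q−1}` of an `E`-split Kolyvagin
  prime `q` with `p^{m_q} ∥ q − 1` (`χ_Λ(Fr_q) mod p = (1+T)^{b_q}`, `v_p(b_q) = m_q − 1`):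
  `one_add_X_pow_sub_one_eq_X_pow_mul_unit`.
* §2 = §5 STEP 4, the count: in `A_J = k⟦T⟧/(T^J)`, `J = 2e`, an identity
  `T^ε · U · T^{e+a} · c = 0` with `U` a unit and `v_T(c) = ν ≤ 1` forces `ε + e + a + ν ≥ 2e`, which
  contradicts the choice `e ≥ a + ε + 2` of the level: `not_X_pow_two_mul_dvd_of_le` /
  `step4_contradiction` (stated in `k⟦T⟧` through divisibility by `T^{2e}`).
* §3 = §4 LEMMA 3 (i), in the coordinate model `𝒯_e = E[p] ⊗ A_e ≅ V^e` (`V = E[p]`, the `i`-th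
  coordinate = the coefficient of `T^i`, `T` = the shift, `Ḡ` acting diagonally): **every subspace of
  `V^e` stable under the shift and under an IRREDUCIBLE set of operators on `V` is one of the
  `T^j 𝒯_e = {x : x_i = 0 for i < j}`, `0 ≤ j ≤ e`** (`shiftStable_submodule_eq_tPow`). The memo proves
  this via absolute irreducibility (`End_Ḡ E[p] = 𝔽_p`); the kernel proof below needs IRREDUCIBILITY
  ONLY (the non-zero lowest coordinate space is `Ḡ`-stable hence all of `V`, and shifting it to the top
  fills the slots downwards), so Lemma 3 (i) also holds at images with `End_Ḡ E[p] ≠ 𝔽_p`. Since a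
  subspace is stable under `γ ↦ (1+T)·` iff under `T`, and under `ι(T) = (1+T)^{-1} − 1 = T·(unit)` iff
  under `T`, the same statement classifies the `G`-submodules of `𝒯_e` AND of `𝒯_e^* ≅ E[p]^*(1) ⊗
  A_e(χ^{-1})` (MU-TRANSFER-PROOF (4.1)).

What is NOT here (next files): Lemma 3 (ii) (`Hom_G(𝒯_j, 𝒯_j^*) = ι`-semilinear scalars, which DOES
use `End_Ḡ E[p] = 𝔽_p`), Lemma 3 (iii) (Goursat — Mathlib `Submodule.goursat` + §3 + orders) and
Lemma 4 (the graph pairing has valuation `≤ 1`; its ring identities are already kernel-checked in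
`Rank1ResidualX9IotaPairing.lean`, p407217).

References: HOME/koly/MU-TRANSFER-PROOF.md §§1, 4, 5 (cell theorem; referee PASS v4–v8, finite checks
kit j245043); B. Mazur, K. Rubin, *Kolyvagin systems*, Mem. AMS 799 (2004) §4.4 (the prototype count).
-/

-- the summit and its single problem are both named `BirchSwinnertonDyer` (registry layout D-0017)
set_option linter.dupNamespace false

set_option autoImplicit false

namespace Summit.BirchSwinnertonDyer.BirchSwinnertonDyer.Rank1Residual.LevelE

open PowerSeries

/-! ### §1 (F5): the depth of an `E`-split prime, `(1+T)^{p^m u} − 1 = T^{p^m}·unit` in characteristic `p` -/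

section F5

variable {k : Type*} [Field k] {p : ℕ} [Fact p.Prime] [CharP k p]

/-- `(1 + T)^{p^m} = 1 + T^{p^m}` in `k⟦T⟧`, `char k = p` (Frobenius). [folklore] -/
theorem one_add_X_pow_prime_pow (m : ℕ) :
    ((1 : k⟦X⟧) + X) ^ p ^ m = 1 + X ^ p ^ m := by
  haveI : CharP k⟦X⟧ p := charP_of_injective_algebraMap (algebraMap k k⟦X⟧).injective p
  rw [add_pow_char_pow (1 : k⟦X⟧) X p m, one_pow]

/-- **MU-TRANSFER-PROOF (F5).** In `Ω = k⟦T⟧` of characteristic `p`, for `u` prime to `p`: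
`(1+T)^{p^m·u} − 1 = T^{p^m} · v` with `v` a UNIT (indeed `v ≡ u (mod T)`). With `p^{m+1} ∥ q − 1`,
`⟨q⟩ = γ^{b_q}`, `b_q = p^m u`, this says `χ_Λ(Fr_q) − 1 = T^{e_q}·unit` in `Λ/p`, `e_q = p^m`: the
Frobenius of an `E`-split prime acts on `𝒯 = E[p] ⊗ Ω(χ)` as a scalar congruent to `1` exactly modulo
`T^{e_q}`. [folklore] -/
theorem one_add_X_pow_sub_one_eq_X_pow_mul_unit (m u : ℕ) (hu : ¬ p ∣ u) :
    ∃ v : k⟦X⟧, IsUnit v ∧ ((1 : k⟦X⟧) + X) ^ (p ^ m * u) - 1 = X ^ p ^ m * v := by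
  -- `(1 + Y)^u - 1 = Y · (u + Y·r)` for `Y = X^{p^m}`
  have key : ∀ n : ℕ, ∃ r : k⟦X⟧, ((1 : k⟦X⟧) + X ^ p ^ m) ^ n =
      1 + (n : k⟦X⟧) * X ^ p ^ m + (X ^ p ^ m) ^ 2 * r := by
    intro n
    induction n with
    | zero => exact ⟨0, by ring⟩
    | succ n ih =>
      obtain ⟨r, hr⟩ := ih
      refine ⟨r + (n : k⟦X⟧) + X ^ p ^ m * r, ?_⟩
      rw [pow_succ, hr]
      push_cast
      ring
  obtain ⟨r, hr⟩ := key u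
  refine ⟨(u : k⟦X⟧) + X ^ p ^ m * r, ?_, ?_⟩
  · -- unit: constant coefficient `u ≠ 0` in `k`
    apply PowerSeries.isUnit_iff_constantCoeff.mpr
    have hu' : ((u : k)) ≠ 0 := by
      intro h
      exact hu ((CharP.cast_eq_zero_iff k p u).mp h)
    have hpm : p ^ m ≠ 0 := pow_ne_zero _ (Fact.out : p.Prime).ne_zero
    rw [map_add, map_mul, map_natCast, map_pow, constantCoeff_X, zero_pow hpm, zero_mul, add_zero]
    exact hu'.isUnit
  · rw [pow_mul, one_add_X_pow_prime_pow, hr]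
    ring

end F5

/-! ### §2 MU-TRANSFER-PROOF §5 STEP 4: the exponent count in `A_J = k⟦T⟧/(T^{2e})` -/

section Step4

variable {k : Type*} [Field k]

/-- `v_T(c) ≤ 1` and `T^{2e} ∣ T^n · c` force `2e ≤ n + 1` (in `k⟦T⟧`): the valuation of the
right-hand side is at most `n + 1`. [folklore] -/
theorem le_of_X_pow_dvd_X_pow_mul {c : k⟦X⟧} (hc : ¬ X ^ 2 ∣ c) {n e : ℕ}
    (h : X ^ (2 * e) ∣ X ^ n * c) : 2 * e ≤ n + 1 := by
  by_contra hlt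
  push Not at hlt
  -- `X^{n+2} ∣ X^{2e} ∣ X^n c`, cancel `X^n`
  have h2 : X ^ (n + 2) ∣ X ^ n * c := (pow_dvd_pow X (by omega)).trans h
  rw [pow_add] at h2
  exact hc ((mul_dvd_mul_iff_left (pow_ne_zero n X_ne_zero)).mp h2)

/-- **MU-TRANSFER-PROOF §5, STEP 4 — the contradiction, kernel-checked.** At level `J = 2e` chosen
with `e ≥ a + ε + 2`, reciprocity gives `0 = ±T^ε · U · T^{e+a} · ⟨k_1, c_y(Fr)⟩` in `A_J = Ω/T^{2e}`
with `U` a unit and `⟨k_1, c_y(Fr)⟩ = T^ν·(unit)`, `ν ≤ 1` (Lemma 4 read through (F7) and Step 2);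
in `Ω = k⟦T⟧` this is `T^{2e} ∣ T^ε · U · T^{e+a} · c` with `T² ∤ c`, which is impossible:
`ε + (e + a) + 1 < 2e`. [folklore] -/
theorem step4_contradiction {U c : k⟦X⟧} (hU : IsUnit U) (hc : ¬ X ^ 2 ∣ c) {e a ε : ℕ}
    (he : a + ε + 2 ≤ e) (h : X ^ (2 * e) ∣ X ^ ε * U * X ^ (e + a) * c) : False := by
  have h' : X ^ (2 * e) ∣ X ^ (ε + (e + a)) * (U * c) := by
    rw [pow_add]
    convert h using 1
    ring
  have hc' : ¬ X ^ 2 ∣ U * c := fun hd => hc (hU.dvd_mul_left.mp hd)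
  have := le_of_X_pow_dvd_X_pow_mul hc' h'
  omega

end Step4

/-! ### §3 MU-TRANSFER-PROOF §4 LEMMA 3 (i): shift-stable `Ḡ`-submodules of `V^e` are the `T^j V^e` -/

section Lemma3i

variable {k : Type*} [Field k] {V : Type*} [AddCommGroup V] [Module k V] {e : ℕ}

/-- Coordinates of iterates of a shift operator `T` on `V^e` (`(Tx)_0 = 0`, `(Tx)_{i+1} = x_i`):
`(T^r x)_i = x_{i−r}` for `r ≤ i` and `0` for `i < r`. [folklore] -/
theorem shift_pow_apply (T : (Fin e → V) →ₗ[k] (Fin e → V))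
    (hT0 : ∀ (x : Fin e → V) (i : Fin e), i.val = 0 → T x i = 0)
    (hTs : ∀ (x : Fin e → V) (i j : Fin e), j.val = i.val + 1 → T x j = x i)
    (r : ℕ) (x : Fin e → V) (i : Fin e) :
    (T ^ r) x i = if h : r ≤ i.val then x ⟨i.val - r, by omega⟩ else 0 := by
  induction r generalizing i with
  | zero => simp
  | succ r ih =>
    rw [pow_succ', Module.End.mul_apply]
    by_cases hi : i.val = 0
    · rw [hT0 _ i hi, dif_neg (by omega)]
    · have hj : i.val = (⟨i.val - 1, by omega⟩ : Fin e).val + 1 := by simp; omega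
      rw [hTs _ ⟨i.val - 1, by omega⟩ i hj, ih]
      by_cases hr : r + 1 ≤ i.val
      · rw [dif_pos (by simp; omega), dif_pos hr]
        congr 2
        omega
      · rw [dif_neg (by simp; omega), dif_neg hr]

/-- **MU-TRANSFER-PROOF §4, Lemma 3 (i), kernel-checked (irreducibility only).** Let `V` be a
`k`-space on which a set `S` of operators acts IRREDUCIBLY (no `S`-stable subspace other than `⊥`,
`⊤`), and let `T` be the shift on `V^e = (Fin e → V)` (the multiplication by `T` on
`𝒯_e = V ⊗ k[T]/(T^e)` in `T`-adic coordinates). Then every subspace `N ≤ V^e` stable under `T` and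
under the diagonal action of `S` is `T^j V^e = {x : x_i = 0 for all i < j}` for some `0 ≤ j ≤ e`.
(For `𝒯_e = E[p] ⊗ A_e(χ)`: `G`-stable = `Ḡ`-stable and `(1+T)`-stable = `Ḡ`-stable and `T`-stable,
so these are exactly the `𝔽_p[G]`-submodules; likewise for `𝒯_e^*` with `ι(T) = T·unit`.) Proof:
with `j` the least index carrying a non-zero coordinate on `N`, the `j`-th coordinates of `N` form a
non-zero `S`-stable subspace, i.e. all of `V`; and if every `y` vanishing below slot `m + 1` lies in
`N` (`m ≥ j`), so does every `y` vanishing below slot `m`: subtract `T^{m−j}x` for `x ∈ N` with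
`x_j = y_m`. [folklore] -/
theorem shiftStable_submodule_eq_tPow (S : Set (V →ₗ[k] V))
    (hirr : ∀ W : Submodule k V, (∀ g ∈ S, ∀ v ∈ W, g v ∈ W) → W = ⊥ ∨ W = ⊤)
    (T : (Fin e → V) →ₗ[k] (Fin e → V))
    (hT0 : ∀ (x : Fin e → V) (i : Fin e), i.val = 0 → T x i = 0)
    (hTs : ∀ (x : Fin e → V) (i j : Fin e), j.val = i.val + 1 → T x j = x i)
    (N : Submodule k (Fin e → V)) (hNT : ∀ x ∈ N, T x ∈ N)
    (hNS : ∀ g ∈ S, ∀ x ∈ N, (fun i => g (x i)) ∈ N) :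
    ∃ j : ℕ, j ≤ e ∧ ∀ x : Fin e → V, x ∈ N ↔ ∀ i : Fin e, i.val < j → x i = 0 := by
  classical
  by_cases hN : ∀ x ∈ N, x = 0
  · -- `N = 0 = T^e V^e`
    refine ⟨e, le_rfl, fun x => ⟨fun hx i _ => by rw [hN x hx]; rfl, fun hx => ?_⟩⟩
    have : x = 0 := funext fun i => hx i i.isLt
    rw [this]
    exact N.zero_mem
  · push Not at hN
    -- `j` = the least index carrying a non-zero coordinate of some element of `N`
    have hex : ∃ j : ℕ, ∃ x ∈ N, ∃ h : j < e, x ⟨j, h⟩ ≠ 0 := by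
      obtain ⟨x, hx, hx0⟩ := hN
      obtain ⟨i, hi⟩ : ∃ i, x i ≠ 0 := by
        by_contra hall
        push Not at hall
        exact hx0 (funext hall)
      exact ⟨i.val, x, hx, i.isLt, hi⟩
    obtain ⟨x₀, hx₀N, hje, hx₀j⟩ := Nat.find_spec hex
    set j := Nat.find hex with hjdef
    have hmin : ∀ x ∈ N, ∀ i : Fin e, i.val < j → x i = 0 := by
      intro x hx i hi
      by_contra hne
      exact Nat.find_min hex hi ⟨x, hx, i.isLt, hne⟩
    -- the `j`-th coordinates of `N` form a non-zero `S`-stable subspace, hence all of `V`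
    let W : Submodule k V := N.map (LinearMap.proj (⟨j, hje⟩ : Fin e))
    have hWS : ∀ g ∈ S, ∀ v ∈ W, g v ∈ W := by
      intro g hg v hv
      obtain ⟨x, hx, rfl⟩ := Submodule.mem_map.mp hv
      exact Submodule.mem_map.mpr ⟨fun i => g (x i), hNS g hg x hx, rfl⟩
    have hWtop : W = ⊤ := by
      rcases hirr W hWS with hbot | htop
      · exfalso
        have : x₀ ⟨j, hje⟩ ∈ W := Submodule.mem_map.mpr ⟨x₀, hx₀N, rfl⟩
        rw [hbot, Submodule.mem_bot] at this
        exact hx₀j this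
      · exact htop
    have hsurj : ∀ v : V, ∃ x ∈ N, x ⟨j, hje⟩ = v := by
      intro v
      have hv : v ∈ W := by rw [hWtop]; exact Submodule.mem_top
      obtain ⟨x, hx, hxv⟩ := Submodule.mem_map.mp hv
      exact ⟨x, hx, hxv⟩
    -- `T^r` maps `N` into `N`
    have hTpow : ∀ (r : ℕ), ∀ x ∈ N, (T ^ r) x ∈ N := by
      intro r
      induction r with
      | zero => intro x hx; rw [pow_zero, Module.End.one_apply]; exact hx
      | succ r ihr =>
        intro x hx
        rw [pow_succ', Module.End.mul_apply]
        exact hNT _ (ihr x hx)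
    -- downward induction: every `y` vanishing below slot `e - d` lies in `N`, for `e - d ≥ j`
    have hslots : ∀ d : ℕ, d + j ≤ e →
        ∀ y : Fin e → V, (∀ i : Fin e, i.val + d < e → y i = 0) → y ∈ N := by
      intro d
      induction d with
      | zero =>
        intro _ y hy
        have : y = 0 := funext fun i => hy i (by rw [add_zero]; exact i.isLt)
        rw [this]
        exact N.zero_mem
      | succ d ih =>
        intro hd y hy
        -- the slot `m = e - d - 1 ≥ j`
        have hme : e - d - 1 < e := by omega
        set m : Fin e := ⟨e - d - 1, hme⟩ with hmdef
        obtain ⟨x, hx, hxv⟩ := hsurj (y m)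
        have hz : (T ^ (m.val - j)) x ∈ N := hTpow _ x hx
        -- `y - T^{m-j} x` vanishes below slot `m + 1`
        have hdiff : y - (T ^ (m.val - j)) x ∈ N := by
          refine ih (by omega) _ fun i hi => ?_
          rw [Pi.sub_apply, shift_pow_apply T hT0 hTs, sub_eq_zero]
          by_cases him : i = m
          · subst him
            rw [dif_pos (by simp [hmdef])]
            have : (⟨m.val - (m.val - j), by omega⟩ : Fin e) = ⟨j, hje⟩ := by
              ext
              simp only [hmdef]
              omega
            rw [this, hxv]
          · have hlt : i.val < m.val := by
              have : i.val ≠ m.val := fun h => him (Fin.ext h)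
              simp only [hmdef] at this ⊢
              omega
            rw [hy i (by simp only [hmdef] at hlt; omega)]
            by_cases hr : m.val - j ≤ i.val
            · rw [dif_pos hr]
              exact (hmin x hx _ (by simp only [hmdef] at hlt hr ⊢; omega)).symm
            · rw [dif_neg hr]
        have := N.add_mem hdiff hz
        rwa [sub_add_cancel] at this
    refine ⟨j, hje.le, fun x => ⟨fun hx i hi => hmin x hx i hi, fun hx => ?_⟩⟩
    exact hslots (e - j) (by omega) x fun i hi => hx i (by omega)

end Lemma3i

end Summit.BirchSwinnertonDyer.BirchSwinnertonDyer.Rank1Residual.LevelE
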